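import Mathlib
import Summits.Ventures.PercRepro2.Defs
import Summits.Ventures.PercRepro2.Independence
import Summits.Ventures.PercRepro2.Harris
import Summits.Ventures.PercRepro2.Graph
import Summits.Ventures.PercRepro2.Exploration
import Summits.Ventures.PercRepro2.Events
import Summits.Ventures.PercRepro2.FourFunctions
import Summits.Ventures.PercRepro2.Induced
import Summits.Ventures.PercRepro2.Frontier
import Summits.Ventures.PercRepro2.ObsIndependence
import Summits.Ventures.PercRepro2.BHK
import Summits.Ventures.PercRepro2.BHKEvents
import Summits.Ventures.PercRepro2.MultiSource
import Summits.Ventures.PercRepro2.OrderPreservation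
import Summits.Ventures.PercRepro2.SeedSet
import Summits.Ventures.PercRepro2.MultiSourceFun
import Summits.Ventures.PercRepro2.CrossRootT
import Summits.Ventures.PercRepro2.VdBKahn
import Summits.Ventures.PercRepro2.HullDefs
import Summits.Ventures.PercRepro2.CCTRootEdge
import Summits.Ventures.PercRepro2.R1Rung
import Summits.Ventures.PercRepro2.CC2Rung
import Summits.Ventures.PercRepro2.PASubDefs
import Summits.Ventures.PercRepro2.HalfN
import Summits.Ventures.PercRepro2.CCTLin
import Summits.Ventures.PercRepro2.LemmaN

/-!
# (CC-T⁻) at a root edge is Lemma N + Harris (blind cell PercRepro2, typer-1; mine-c g3 §10.3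
"(CC-T⁻) [T1 ≥ 0]", the prover target of row 2′CCT-LIN; MINEC-THEOREMS.md Lemma N)

For `e = {s, w}`, opening `e` glues `C(w)` to `C(s)`, so the `e`-open avoidance `R⁺` is
`{s ∉ K⁻, w ∉ K⁻}` with `K⁻ = C_{ω⁻}(T)` the `e`-closed `T`-hull (`Rplus_root_eq`). Conditioning on
`K⁻ = W` (`mem_Xminus_iff_of_KM`: the `e`-closed connections are their `W`-deleted versions, independent
of `{K⁻ = W}`), Harris gives `P(X_W ∩ Y_W) ≥ x₀(W) y₀(W)`, and Lemma N (`LemmaN.lemmaN` with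
`{u, w} = {s, w}`) gives the centred sum over `{s, w ∉ K⁻}`: **`cctMinus_root_edge`**. Together with
`CCTMinusEdge.cctMinus_avoided_edge`, the target (CC-T⁻) is a theorem at every edge touching
`{s} ∪ T`; the free edge remains the open content.
-/

namespace Summit.Ventures.PercRepro2

namespace CCTLin

open PASub HalfN LemmaN TwoSetRung

open scoped Classical

variable {V : Type*} {E : Type*} [Fintype E] [DecidableEq E] [Fintype V] [DecidableEq V]
  {R : Type*} [Field R] [LinearOrder R] [IsStrictOrderedRing R]

section Frame

variable (p : E → R) (ends : E → Sym2 V) (e : E) (s : V) (T : Finset V)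

omit [Fintype V] [DecidableEq V] [LinearOrder R] [IsStrictOrderedRing R] in
/-- The `e`-closed masses as events of `ω`: `massF p₀ = P({ω⁻ ∈ R_T ∩ X_A})`. -/
lemma massF_update_zero_eq' (A : Finset V) :
    massF (Function.update p e 0) ends s A T =
      prob p {ω | Function.update ω e false ∈ avoidAll ends s T ∩ connAll ends s A} := by
  unfold massF
  rw [CCT.prob_update_zero_eq]

omit [Fintype V] [DecidableEq V] [LinearOrder R] [IsStrictOrderedRing R] in
/-- `massP p₀ = P({ω⁻ ∈ R_T})`. -/
lemma massP_update_zero_eq' :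
    massP (Function.update p e 0) ends s T =
      prob p {ω | Function.update ω e false ∈ avoidAll ends s T} := by
  unfold massP
  rw [CCT.prob_update_zero_eq]

omit [Fintype E] [DecidableEq V] [Fintype V] in
/-- `ω⁻` avoids `T` from `s` iff `s ∉ K⁻`. -/
lemma update_false_mem_avoidAll_iff (ω : Config E) :
    Function.update ω e false ∈ avoidAll ends s T ↔ s ∉ KsetM ends e T ω := by
  simp only [avoidAll, Set.mem_setOf_eq, KsetM, mem_clusterSet, not_exists, not_and]
  exact ⟨fun h t ht hc => h t ht (conn_symm hc), fun h t ht hc => h t ht (conn_symm hc)⟩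

omit [Fintype E] [DecidableEq V] [Fintype V] in
/-- On `{K⁻ = W}` (with `s ∉ W`), the `e`-closed connection equals its `W`-deleted version. -/
lemma mem_Xminus_iff_of_KM {ω : Config E} {W : Set V} (hK : KsetM ends e T ω = W) (hs : s ∉ W)
    (a : V) : ω ∈ Xminus ends e s a ↔ ω ∈ Xdel ends e s W a := by
  simp only [Xminus, Xdel, Set.mem_setOf_eq]
  constructor
  · intro hc
    have hsub : cluster ends (Function.update ω e false) s ⊆ Wᶜ := by
      intro x hx hxW
      apply hs
      rw [← hK]
      obtain ⟨t, ht, htx⟩ := hK ▸ hxW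
      exact ⟨t, ht, conn_trans htx (conn_symm hx)⟩
    exact conn_delConfig_of_cluster_subset_compl ends hsub hc
  · intro hc
    exact conn_mono (fun e' => by
      by_cases h : e' ∈ touches ends W
      · rw [delConfig_apply_of_mem h]; exact Bool.false_le _
      · rw [delConfig_apply_of_notMem h]) hc

omit [DecidableEq V] [LinearOrder R] [IsStrictOrderedRing R] in
/-- The partition of `A ∩ {Q(K⁻)}` by the value of `K⁻`. -/
lemma prob_inter_KM_eq_sum (Q : Set V → Prop) (A : Set (Config E)) :
    prob p (A ∩ {ω | Q (KsetM ends e T ω)}) =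
      ∑ W : Set V, if Q W then prob p (A ∩ KEventM ends e T W) else 0 := by
  unfold prob
  have hmove : ∀ W : Set V,
      (if Q W then ∑ ω, (A ∩ KEventM ends e T W).indicator (weight p) ω else 0) =
        ∑ ω, if Q W then (A ∩ KEventM ends e T W).indicator (weight p) ω else 0 := by
    intro W
    split_ifs <;> simp
  simp_rw [hmove]
  rw [Finset.sum_comm]
  refine Finset.sum_congr rfl fun ω _ => ?_
  rw [Finset.sum_eq_single (KsetM ends e T ω)]
  · by_cases hQ : Q (KsetM ends e T ω)
    · rw [if_pos hQ]
      by_cases hA : ω ∈ A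
      · have h1 : ω ∈ A ∩ {ω | Q (KsetM ends e T ω)} := ⟨hA, hQ⟩
        have h2 : ω ∈ A ∩ KEventM ends e T (KsetM ends e T ω) := ⟨hA, rfl⟩
        rw [Set.indicator_of_mem h1, Set.indicator_of_mem h2]
      · have h1 : ω ∉ A ∩ {ω | Q (KsetM ends e T ω)} := fun h => hA h.1
        have h2 : ω ∉ A ∩ KEventM ends e T (KsetM ends e T ω) := fun h => hA h.1
        rw [Set.indicator_of_notMem h1, Set.indicator_of_notMem h2]
    · rw [if_neg hQ, Set.indicator_of_notMem]
      intro h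
      exact hQ h.2
  · intro W _ hW
    by_cases hQ : Q W
    · have h2 : ω ∉ A ∩ KEventM ends e T W := fun h => hW h.2.symm
      rw [if_pos hQ, Set.indicator_of_notMem h2]
    · rw [if_neg hQ]
  · intro h
    exact absurd (Finset.mem_univ _) h

omit [Fintype V] [DecidableEq V] [LinearOrder R] [IsStrictOrderedRing R] in
/-- Independence of `X_W ∩ Y_W` from `{K⁻ = W}`. -/
lemma prob_Xdel_inter_Xdel_inter_KEventM (W : Set V) (a b : V) :
    prob p (Xdel ends e s W a ∩ Xdel ends e s W b ∩ KEventM ends e T W) =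
      prob p (Xdel ends e s W a ∩ Xdel ends e s W b) * prob p (KEventM ends e T W) := by
  have hd := dependsOn_inter (dependsOn_Xdel ends e s W a) (dependsOn_Xdel ends e s W b)
  rw [Set.union_self] at hd
  exact prob_inter_eq_mul_of_dependsOn p (F₁ := (touches ends W)ᶜ) (F₂ := touches ends W)
    disjoint_compl_left hd (dependsOn_KEventM ends e T W)

omit [Fintype V] [DecidableEq V] [LinearOrder R] [IsStrictOrderedRing R] in
/-- Independence of `X_W` from `{K⁻ = W}`. -/
lemma prob_Xdel_inter_KEventM (W : Set V) (a : V) :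
    prob p (Xdel ends e s W a ∩ KEventM ends e T W) =
      prob p (Xdel ends e s W a) * prob p (KEventM ends e T W) :=
  prob_inter_eq_mul_of_dependsOn p (F₁ := (touches ends W)ᶜ) (F₂ := touches ends W)
    disjoint_compl_left (dependsOn_Xdel ends e s W a) (dependsOn_KEventM ends e T W)

end Frame

section Root

variable (p : E → R) (ends : E → Sym2 V) {e : E} {s w : V} (T : Finset V)

omit [Fintype E] [DecidableEq V] [Fintype V] in
/-- At a root edge `e = {s, w}`: `R⁺ = {s ∉ K⁻, w ∉ K⁻}`. -/
lemma Rplus_root_eq (hends : ends e = s(s, w)) :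
    Rplus ends e s T = {ω | s ∉ KsetM ends e T ω ∧ w ∉ KsetM ends e T ω} := by
  ext ω
  simp only [Rplus, Set.mem_setOf_eq]
  rw [CCT.update_true_mem_avoidAll_iff hends ω T, update_false_mem_avoidAll_iff]
  simp only [clusterSetInEvent, Set.mem_setOf_eq, KsetM]

omit [LinearOrder R] [IsStrictOrderedRing R] in
/-- The masses of (CC-T⁻) at a root edge through the `K⁻`-frame: a generic `sumX` identity. -/
lemma prob_Xminus_inter_pred_eq (X : Finset V) (hs : s ∈ X) (a : V) :
    prob p (Xminus ends e s a ∩ {ω | ∀ v ∈ X, v ∉ KsetM ends e T ω}) =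
      sumX p ends e T X (fun W => prob p (Xdel ends e s W a)) := by
  unfold sumX
  rw [prob_inter_KM_eq_sum p ends e T (fun W => ∀ v ∈ X, v ∉ W)]
  refine Finset.sum_congr rfl fun W _ => ?_
  by_cases hQ : ∀ v ∈ X, v ∉ W
  · rw [if_pos hQ, if_pos hQ, ← prob_Xdel_inter_KEventM]
    congr 1
    ext ω
    simp only [Set.mem_inter_iff]
    constructor
    · rintro ⟨hx, hK⟩; exact ⟨(mem_Xminus_iff_of_KM ends e s T hK (hQ s hs) a).1 hx, hK⟩
    · rintro ⟨hx, hK⟩; exact ⟨(mem_Xminus_iff_of_KM ends e s T hK (hQ s hs) a).2 hx, hK⟩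
  · rw [if_neg hQ, if_neg hQ]

/-- The joint mass dominates the linearised one (Harris termwise). -/
lemma sumX_le_prob_Xminus_inter_Xminus_inter_pred (hp : IsProbVec p) (X : Finset V) (hs : s ∈ X)
    (a b : V) :
    sumX p ends e T X (fun W => prob p (Xdel ends e s W a) * prob p (Xdel ends e s W b)) ≤
      prob p (Xminus ends e s a ∩ Xminus ends e s b ∩ {ω | ∀ v ∈ X, v ∉ KsetM ends e T ω}) := by
  unfold sumX
  rw [prob_inter_KM_eq_sum p ends e T (fun W => ∀ v ∈ X, v ∉ W)]
  refine Finset.sum_le_sum fun W _ => ?_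
  by_cases hQ : ∀ v ∈ X, v ∉ W
  · rw [if_pos hQ, if_pos hQ]
    have hset : Xminus ends e s a ∩ Xminus ends e s b ∩ KEventM ends e T W =
        Xdel ends e s W a ∩ Xdel ends e s W b ∩ KEventM ends e T W := by
      ext ω
      simp only [Set.mem_inter_iff]
      constructor
      · rintro ⟨⟨hx, hy⟩, hK⟩
        exact ⟨⟨(mem_Xminus_iff_of_KM ends e s T hK (hQ s hs) a).1 hx,
          (mem_Xminus_iff_of_KM ends e s T hK (hQ s hs) b).1 hy⟩, hK⟩
      · rintro ⟨⟨hx, hy⟩, hK⟩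
        exact ⟨⟨(mem_Xminus_iff_of_KM ends e s T hK (hQ s hs) a).2 hx,
          (mem_Xminus_iff_of_KM ends e s T hK (hQ s hs) b).2 hy⟩, hK⟩
    rw [hset, prob_Xdel_inter_Xdel_inter_KEventM]
    exact mul_le_mul_of_nonneg_right
      (prob_mul_prob_le_prob_inter hp (isUpperSet_Xdel ends e s W a) (isUpperSet_Xdel ends e s W b))
      (prob_nonneg hp _)
  · rw [if_neg hQ, if_neg hQ]

omit [LinearOrder R] [IsStrictOrderedRing R] in
/-- `P({∀ v ∈ X, v ∉ K⁻}) = sumX X 1`. -/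
lemma prob_pred_eq_sumX (X : Finset V) :
    prob p {ω | ∀ v ∈ X, v ∉ KsetM ends e T ω} = sumX p ends e T X (fun _ => 1) := by
  unfold sumX
  have := prob_inter_KM_eq_sum p ends e T (fun W => ∀ v ∈ X, v ∉ W) Set.univ
  rw [Set.univ_inter] at this
  rw [this]
  refine Finset.sum_congr rfl fun W _ => ?_
  by_cases hQ : ∀ v ∈ X, v ∉ W
  · simp only [if_pos hQ, Set.univ_inter, one_mul]
  · simp only [if_neg hQ]

/-- **(CC-T⁻) at a root edge** `e = {s, w}`: Lemma N with `{u, w} = {s, w}` plus Harris. -/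
theorem cctMinus_root_edge (hp : IsProbVec p) (hends : ends e = s(s, w)) (a b : V) :
    CCTMinus p ends e s T a b := by
  unfold CCTMinus
  rw [Rplus_root_eq ends T hends, massP_update_zero_eq', massF_update_zero_eq',
    massF_update_zero_eq']
  -- the `e`-closed masses as `sumX {s}`-sums
  have hS : {ω | Function.update ω e false ∈ avoidAll ends s T} =
      {ω | ∀ v ∈ ({s} : Finset V), v ∉ KsetM ends e T ω} := by
    ext ω
    simp only [Set.mem_setOf_eq, update_false_mem_avoidAll_iff, Finset.mem_singleton, forall_eq]
  have hF : ∀ c : V, {ω | Function.update ω e false ∈ avoidAll ends s T ∩ connAll ends s {c}} =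
      Xminus ends e s c ∩ {ω | ∀ v ∈ ({s} : Finset V), v ∉ KsetM ends e T ω} := by
    intro c
    ext ω
    simp only [Set.mem_setOf_eq, Set.mem_inter_iff, update_false_mem_avoidAll_iff, Xminus, connAll,
      Finset.mem_singleton, forall_eq]
    tauto
  have hR : {ω | s ∉ KsetM ends e T ω ∧ w ∉ KsetM ends e T ω} =
      {ω | ∀ v ∈ ({s, s, w} : Finset V), v ∉ KsetM ends e T ω} := by
    ext ω
    simp only [Set.mem_setOf_eq, Finset.mem_insert, Finset.mem_singleton, forall_eq_or_imp,
      forall_eq]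
    tauto
  rw [hS, hF, hF, hR, prob_pred_eq_sumX, prob_pred_eq_sumX,
    prob_Xminus_inter_pred_eq p ends T {s} (Finset.mem_singleton_self s),
    prob_Xminus_inter_pred_eq p ends T {s} (Finset.mem_singleton_self s)]
  have hsX : s ∈ ({s, s, w} : Finset V) := by simp
  rw [prob_Xminus_inter_pred_eq p ends T _ hsX, prob_Xminus_inter_pred_eq p ends T _ hsX]
  have hN := LemmaN.lemmaN p ends e s T hp s w a b
  have hH := sumX_le_prob_Xminus_inter_Xminus_inter_pred p ends (e := e) T hp {s, s, w} hsX a b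
  have hS0 : 0 ≤ sumX p ends e T {s} (fun _ => (1 : R)) ^ 2 := sq_nonneg _
  nlinarith [hN, mul_le_mul_of_nonneg_left hH hS0]

end Root

end CCTLin

end Summit.Ventures.PercRepro2
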